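import Summits.Ventures.YMGap.FlowData.RectTubeMagneticTwist
import Summits.Ventures.YMGap.FlowData.RectTubeReweightedKernel
import HarnessLib

/-!
# Venture YMGap, track Y3 FLOW-DATA — the magnetic-flux energy is SANDWICHED by vacuum plaquette expectations:
# `J·⟨mag − magTw_ζ⟩_{Ω_ζ} ≤ E_mag(ζ) ≤ J·⟨mag − magTw_ζ⟩_Ω`; SU(2): `E_mag(β;S) ≤ 2β·Σ_{p∈S} ⟨½Tr U_p⟩_Ω` (theorems only)

HONEST FRAMING: venture file of the cell `pub-ymgap` (QuantumFields programme), track Y3 (FLOW-DATA); companion THEOREMS of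
`RectTubeMagneticTwist.lean` (FLOW-PLAN O6 typed) obtained from the Jensen–Feynman sandwich `RectTubeReweightedKernel.lean`
(the twisted kernel is the reweighting `g = (J/2)(magTw_ζ − mag)` of the Wilson kernel).  Finite spatial torus; a RELATION between
two FLOW-TABLE observables (O6 `E_mag` and the vacuum plaquette expectation behind O7's `P_s`), no number, no row; nothing about
`L → ∞`, the continuum or a mass gap; the sign of `E_mag` is not claimed (the lower bound involves the twisted vacuum).

* `exists_rectTwistedVacuum` — the twisted operator has a unit, a.e. positive, simple top eigenvector `Ω_ζ` (Jentzsch);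
* **`rectMagneticFluxEnergy_le_integral`** — for every unit top eigenvector `Ω` of `T` (`J ≥ 0`, continuous unitary `ρ`):
  `E_mag(ζ) ≤ ∫ J·(mag − magTw_ζ)·Ω²` (Gibbs–Bogoliubov: variational principle through the untwisted vacuum + Jensen);
* **`integral_le_rectMagneticFluxEnergy`** — for every unit top eigenvector `Ω_ζ` of `T_ζ`: `∫ J·(mag − magTw_ζ)·Ω_ζ² ≤ E_mag(ζ)`;
* the cell's `SU(2)` object (`ζ = −1` on `S`, `J = β/2`; `mag − magTw_S = 2 Σ_{p∈S} Re tr U_p = 4 Σ_{p∈S} ½Tr U_p`):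
  `su2_rectMagSum_sub_rectMagSumTw`, ★ **`su2RectMagneticFluxEnergy_le`**: `E_mag(β; Ls; S) ≤ β ∫ (Σ_{p∈S} Re tr U_p) Ω²`
  `= 2β Σ_{p∈S} ⟨½Tr U_p⟩_Ω` for every unit vacuum `Ω` of the `SU(2)` tube — a cross-check of every magnetic-flux cell against the
  vacuum plaquette expectation (on one-site tori `⟨½Tr U_p⟩_Haar = ¼`, so both sides are `β/2 + O(β²)`: first-order sharp);
  ★ **`su2RectMagneticFluxEnergy_ge`**: `β ∫ (Σ_{p∈S} Re tr U_p) Ω_S² ≤ E_mag(β; Ls; S)` for every unit vacuum `Ω_S` of the twisted tube.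

References: M. Reed, B. Simon IV (1978) §XIII.12 [cite: ReedSimonIV1978, §XIII.12]; G. 't Hooft, Nucl. Phys. B 153 (1979) 141
[cite: tHooft1979Flux]; E. T. Tomboulis, L. G. Yaffe, Commun. Math. Phys. 100 (1985) 313 [cite: TomboulisYaffe1985].
-/

noncomputable section

open scoped BigOperators ENNReal RealInnerProductSpace
open MeasureTheory Filter Function
open Literature.MathematicalPhysics.QuantumFieldTheory Literature.Analysis.OperatorTheory
open Literature.MathematicalPhysics.QuantumLattice (RectTorusSite fundamentalRep continuous_fundamentalRep
  fundamentalRep_mem_unitaryGroup fundamentalRep_apply)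
open Summit.Ventures.YMGap.Census (RectPlaquette rectPlaquetteHolonomy)

namespace Summit.Ventures.YMGap.FlowData

section General

variable {G : Type*} [Group G] [TopologicalSpace G] [IsTopologicalGroup G] [CompactSpace G]
  [MeasurableSpace G] [BorelSpace G] [SecondCountableTopology G] {n k : ℕ} (ρ : G →* Matrix (Fin n) (Fin n) ℂ)
  {J : ℝ} {Ls : Fin k → ℕ} [∀ i, NeZero (Ls i)]

/-- **The twisted vacuum** (Jentzsch): `T_ζ` has a unit, a.e. strictly positive top eigenvector, and the top eigenvalue is simple
(continuous unitary `ρ`). [cite: ReedSimonIV1978, Thm XIII.44] -/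
theorem exists_rectTwistedVacuum (hρ : Continuous ρ) (hρu : ∀ g, ρ g ∈ Matrix.unitaryGroup (Fin n) ℂ) (ζ : RectPlaquette Ls → G) :
    ∃ Ω : Lp ℝ 2 (rectSliceMeasure G Ls), ‖Ω‖ = 1 ∧ IsStrictlyPositiveFun Ω ∧
      rectTubeTwistedOperator ρ J Ls ζ Ω = ‖rectTubeTwistedOperator ρ J Ls ζ‖ • Ω ∧
      ∀ η, rectTubeTwistedOperator ρ J Ls ζ η = ‖rectTubeTwistedOperator ρ J Ls ζ‖ • η → η = (@inner ℝ _ _ Ω η) • Ω := by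
  obtain ⟨Ω, h1, hpos, heig, hsimple, -⟩ :=
    (isPositivityImproving_rectTubeTwistedOperator (J := J) hρ ζ).exists_spectralGap
      (isSelfAdjoint_rectTubeTwistedOperator hρ hρu ζ) (isCompactOperator_rectTubeTwistedOperator hρ ζ)
      (norm_pos_iff.1 (norm_rectTubeTwistedOperator_pos hρ ζ))
  exact ⟨Ω, h1, hpos, heig, hsimple⟩

/-- The twisted kernel in the reweighted form of `RectTubeReweightedKernel`:
`K_ζ(a,b) = e^{g(a)} K(a,b) e^{g(b)}` with `g = (J/2)(magTw_ζ − mag)`. [folklore] -/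
theorem rectTubeTwistedOperator_ae_eq_reweighted (hρ : Continuous ρ) (ζ : RectPlaquette Ls → G)
    (φ : Lp ℝ 2 (rectSliceMeasure G Ls)) :
    (rectTubeTwistedOperator ρ J Ls ζ φ : RectSlice Ls G → ℝ) =ᵐ[rectSliceMeasure G Ls]
      fun a => ∫ b, (Real.exp (J / 2 * (rectMagSumTw ρ ζ a - rectMagSum ρ a)) * rectSliceKernel ρ J J a b *
        Real.exp (J / 2 * (rectMagSumTw ρ ζ b - rectMagSum ρ b))) * φ b ∂(rectSliceMeasure G Ls) := by
  refine (rectTubeTwistedOperator_ae_eq hρ ζ φ).trans (Eventually.of_forall fun a => ?_)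
  refine integral_congr_ae (Eventually.of_forall fun b => ?_)
  simp only [rectSliceKernelTw_eq_mul]

/-- **UPPER BOUND: `E_mag(ζ) ≤ J · ⟨mag − magTw_ζ⟩_Ω`** for every unit top eigenvector `Ω` of the untwisted tube operator
(`J ≥ 0`, continuous unitary `ρ`): the variational principle for `T_ζ` through the untwisted vacuum, then Jensen.
[cite: ReedSimonIV1978, §XIII.12] [cite: tHooft1979Flux] -/
theorem rectMagneticFluxEnergy_le_integral (hρ : Continuous ρ) (hρu : ∀ g, ρ g ∈ Matrix.unitaryGroup (Fin n) ℂ)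
    (hJ : 0 ≤ J) (ζ : RectPlaquette Ls → G) {Ω : Lp ℝ 2 (rectSliceMeasure G Ls)} (h1 : ‖Ω‖ = 1)
    (heig : rectTubeTransferOperator ρ J Ls Ω = ‖rectTubeTransferOperator ρ J Ls‖ • Ω) :
    rectMagneticFluxEnergy ρ J Ls ζ ≤
      ∫ a, (J * (rectMagSum ρ a - rectMagSumTw ρ ζ a)) * (Ω a * Ω a) ∂(rectSliceMeasure G Ls) := by
  have hg : Continuous fun a : RectSlice Ls G => J / 2 * (rectMagSumTw ρ ζ a - rectMagSum ρ a) :=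
    continuous_const.mul ((continuous_rectMagSumTw ρ hρ ζ).sub (continuous_rectMagSum ρ hρ))
  have h := rectTube_log_norm_sub_reweighted_le ρ (Ls := Ls) hρ hρu hJ hg (rectTubeTwistedOperator_ae_eq_reweighted ρ hρ ζ)
    h1 heig
  unfold rectMagneticFluxEnergy
  refine h.trans (le_of_eq (integral_congr_ae (Eventually.of_forall fun a => ?_)))
  ring

/-- **LOWER BOUND: `J · ⟨mag − magTw_ζ⟩_{Ω_ζ} ≤ E_mag(ζ)`** for every unit top eigenvector `Ω_ζ` of the TWISTED operator
(`J ≥ 0`, continuous unitary `ρ`). [cite: ReedSimonIV1978, §XIII.12] [cite: tHooft1979Flux] -/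
theorem integral_le_rectMagneticFluxEnergy (hρ : Continuous ρ) (hρu : ∀ g, ρ g ∈ Matrix.unitaryGroup (Fin n) ℂ)
    (hJ : 0 ≤ J) (ζ : RectPlaquette Ls → G) {Ω' : Lp ℝ 2 (rectSliceMeasure G Ls)} (h1 : ‖Ω'‖ = 1)
    (heig : rectTubeTwistedOperator ρ J Ls ζ Ω' = ‖rectTubeTwistedOperator ρ J Ls ζ‖ • Ω') :
    ∫ a, (J * (rectMagSum ρ a - rectMagSumTw ρ ζ a)) * (Ω' a * Ω' a) ∂(rectSliceMeasure G Ls) ≤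
      rectMagneticFluxEnergy ρ J Ls ζ := by
  have hg : Continuous fun a : RectSlice Ls G => J / 2 * (rectMagSumTw ρ ζ a - rectMagSum ρ a) :=
    continuous_const.mul ((continuous_rectMagSumTw ρ hρ ζ).sub (continuous_rectMagSum ρ hρ))
  have h := rectTube_log_norm_sub_reweighted_ge ρ (Ls := Ls) hρ hρu hJ hg (rectTubeTwistedOperator_ae_eq_reweighted ρ hρ ζ)
    (isSelfAdjoint_rectTubeTwistedOperator hρ hρu ζ) h1 heig
  unfold rectMagneticFluxEnergy
  refine le_trans (le_of_eq (integral_congr_ae (Eventually.of_forall fun a => ?_))) h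
  ring

end General

/-! ### The cell's `SU(2)` object -/

section SU2

variable {k : ℕ} {Ls : Fin k → ℕ} [∀ i, NeZero (Ls i)]

/-- `Re tr(−U) = −Re tr U` in the fundamental representation of `SU(2)`. [folklore] -/
theorem su2_trace_re_su2MinusOne_mul (g : Matrix.specialUnitaryGroup (Fin 2) ℂ) :
    (fundamentalRep (Fin 2) (su2MinusOne * g)).trace.re = -(fundamentalRep (Fin 2) g).trace.re := by
  rw [map_mul, fundamentalRep_apply su2MinusOne, coe_su2MinusOne, neg_one_mul, Matrix.trace_neg, Complex.neg_re]

/-- **`mag − magTw_S = 2 Σ_{p∈S} Re tr U_p`** for the `SU(2)` twist `−1` on `S`. [folklore] -/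
theorem su2_rectMagSum_sub_rectMagSumTw (S : Finset (RectPlaquette Ls)) (a : RectSlice Ls (Matrix.specialUnitaryGroup (Fin 2) ℂ)) :
    rectMagSum (fundamentalRep (Fin 2)) a - rectMagSumTw (fundamentalRep (Fin 2)) (su2PlaquetteTwist S) a =
      2 * ∑ q ∈ S, (fundamentalRep (Fin 2) (rectPlaquetteHolonomy a q.1 q.2.1.1 q.2.1.2)).trace.re := by
  classical
  rw [← rectMagSumTw_one (fundamentalRep (Fin 2)) a]
  unfold rectMagSumTw
  rw [← Finset.sum_sub_distrib]
  simp_rw [← Finset.sum_sub_distrib]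
  rw [← Fintype.sum_prod_type' (f := fun x p =>
    (fundamentalRep (Fin 2) ((1 : RectPlaquette Ls → _) (x, p) * rectPlaquetteHolonomy a x p.1.1 p.1.2)).trace.re -
    (fundamentalRep (Fin 2) (su2PlaquetteTwist S (x, p) * rectPlaquetteHolonomy a x p.1.1 p.1.2)).trace.re)]
  have hq : ∀ q : RectPlaquette Ls,
      (fundamentalRep (Fin 2) ((1 : RectPlaquette Ls → _) q * rectPlaquetteHolonomy a q.1 q.2.1.1 q.2.1.2)).trace.re -
        (fundamentalRep (Fin 2) (su2PlaquetteTwist S q * rectPlaquetteHolonomy a q.1 q.2.1.1 q.2.1.2)).trace.re =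
      if q ∈ S then 2 * (fundamentalRep (Fin 2) (rectPlaquetteHolonomy a q.1 q.2.1.1 q.2.1.2)).trace.re else 0 := by
    intro q
    rw [Pi.one_apply, one_mul]
    split_ifs with h
    · unfold su2PlaquetteTwist
      rw [if_pos h, su2_trace_re_su2MinusOne_mul]; ring
    · rw [su2PlaquetteTwist_of_not_mem q h, one_mul, sub_self]
  simp_rw [hq]
  rw [Finset.sum_ite_mem, Finset.univ_inter, Finset.mul_sum]

/-- **★ `E_mag(β; Ls; S) ≤ β ∫ (Σ_{p∈S} Re tr U_p) Ω² = 2β Σ_{p∈S} ⟨½Tr U_p⟩_Ω`** for every unit top eigenvector (vacuum) `Ω` of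
the `SU(2)` tube operator `rectTubeTransferOperator (fundamentalRep (Fin 2)) (β/2) Ls`, `β ≥ 0`: every magnetic-flux cell is
bounded by `2β` times the vacuum expectation of the twisted plaquettes (first-order sharp at strong coupling).
[cite: tHooft1979Flux] [cite: ReedSimonIV1978, §XIII.12] -/
theorem su2RectMagneticFluxEnergy_le {β : ℝ} (hβ : 0 ≤ β) (Ls : Fin k → ℕ) [∀ i, NeZero (Ls i)]
    (S : Finset (RectPlaquette Ls)) {Ω : Lp ℝ 2 (rectSliceMeasure (Matrix.specialUnitaryGroup (Fin 2) ℂ) Ls)}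
    (h1 : ‖Ω‖ = 1) (heig : rectTubeTransferOperator (fundamentalRep (Fin 2)) (β / 2) Ls Ω =
      ‖rectTubeTransferOperator (fundamentalRep (Fin 2)) (β / 2) Ls‖ • Ω) :
    su2RectMagneticFluxEnergy β Ls S ≤
      β * ∫ a, (∑ q ∈ S, (fundamentalRep (Fin 2) (rectPlaquetteHolonomy a q.1 q.2.1.1 q.2.1.2)).trace.re) * (Ω a * Ω a)
        ∂(rectSliceMeasure (Matrix.specialUnitaryGroup (Fin 2) ℂ) Ls) := by
  haveI : SecondCountableTopology (Matrix.specialUnitaryGroup (Fin 2) ℂ) :=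
    Literature.MathematicalPhysics.QuantumLattice.secondCountableTopology_su2
  have h := rectMagneticFluxEnergy_le_integral (fundamentalRep (Fin 2)) (Ls := Ls) (continuous_fundamentalRep (Fin 2))
    fundamentalRep_mem_unitaryGroup (by positivity : 0 ≤ β / 2) (su2PlaquetteTwist S) h1 heig
  unfold su2RectMagneticFluxEnergy
  refine h.trans (le_of_eq ?_)
  rw [← integral_const_mul]
  refine integral_congr_ae (Eventually.of_forall fun a => ?_)
  dsimp only
  rw [su2_rectMagSum_sub_rectMagSumTw]
  ring

/-- **★ `β ∫ (Σ_{p∈S} Re tr U_p) Ω_S² ≤ E_mag(β; Ls; S)`** for every unit top eigenvector `Ω_S` of the TWISTED `SU(2)` tube operator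
`su2RectTwistedOperator β Ls S`, `β ≥ 0` (the twisted vacuum exists: `exists_rectTwistedVacuum`). [cite: tHooft1979Flux] -/
theorem su2RectMagneticFluxEnergy_ge {β : ℝ} (hβ : 0 ≤ β) (Ls : Fin k → ℕ) [∀ i, NeZero (Ls i)]
    (S : Finset (RectPlaquette Ls)) {Ω' : Lp ℝ 2 (rectSliceMeasure (Matrix.specialUnitaryGroup (Fin 2) ℂ) Ls)}
    (h1 : ‖Ω'‖ = 1) (heig : su2RectTwistedOperator β Ls S Ω' = ‖su2RectTwistedOperator β Ls S‖ • Ω') :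
    β * ∫ a, (∑ q ∈ S, (fundamentalRep (Fin 2) (rectPlaquetteHolonomy a q.1 q.2.1.1 q.2.1.2)).trace.re) * (Ω' a * Ω' a)
        ∂(rectSliceMeasure (Matrix.specialUnitaryGroup (Fin 2) ℂ) Ls) ≤
      su2RectMagneticFluxEnergy β Ls S := by
  haveI : SecondCountableTopology (Matrix.specialUnitaryGroup (Fin 2) ℂ) :=
    Literature.MathematicalPhysics.QuantumLattice.secondCountableTopology_su2
  have h := integral_le_rectMagneticFluxEnergy (fundamentalRep (Fin 2)) (Ls := Ls) (continuous_fundamentalRep (Fin 2))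
    fundamentalRep_mem_unitaryGroup (by positivity : 0 ≤ β / 2) (su2PlaquetteTwist S) h1 heig
  unfold su2RectMagneticFluxEnergy
  refine le_trans (le_of_eq ?_) h
  rw [← integral_const_mul]
  refine integral_congr_ae (Eventually.of_forall fun a => ?_)
  dsimp only
  rw [su2_rectMagSum_sub_rectMagSumTw]
  ring

end SU2

end Summit.Ventures.YMGap.FlowData
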